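import Literature.MathematicalPhysics.QuantumFieldTheory.Balaban1983to89.T4LiveClassFibration
import Literature.MathematicalPhysics.QuantumFieldTheory.Balaban1983to89.T4Continuum
import Literature.MathematicalPhysics.QuantumFieldTheory.Balaban1983to89.T4GenFunBounds

/-!
# `Balaban1983to89.T4StabilitySocket` — the (G2) «low» / (G5) «ratio» half of node U5c's global-denominator
currency (`T4GlobalDenominator.GlobalDom`, `T4LiveClassFibration.Regeneration`) DISCHARGED from the PINNED end statement
(B) = `B16.EndStatementBPrinted := Thm1Printed ∧ Cor3_250` BY NAME, at the final scale `k = K` of the tuned runs,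
integrated over the unit-lattice configurations and dressed by a bounded source (cell `pub-balaban`, T4-DAG v22 §8 Q28
RULING R-U5c-GD; self-row T4-U5c.E-NE7b-PROVE-P2i* (§8 Q24(a)), node U5c / U5.E, spine estimate NE7b, renewal member P2,
generation 9; census item v23 of `t4/T4-EST-NE7b-P2.md`; kernel bookkeeping over `T4LiveClassFibration` +
`T4Continuum` + `T4GenFunBounds`, no sibling module modified)

HONEST FRAMING (T4-DAG PAGE 1).  The cell's T4 target is the existence and uniqueness of the `ε → 0` limit of unit-scale
block-averaged expectations on a FIXED finite torus, at rung (B)+1, CONDITIONAL on Bałaban's ultraviolet stability (B)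
and on BetaPertH; it is NOT infinite volume, NOT the mass gap, NOT the Clay problem.  This module is [folklore] measure
theory and real arithmetic.  NOTHING of Bałaban's is asserted: (B) enters ONLY as the displayed hypothesis
`(hB : B16.EndStatementBPrinted D.C)` (resp. its unpacked `Cor3_250` conjunct `(hcor : B16.Cor3With D.C γB em ep)`), the
sign convention `χ_k ≥ 0` as `(hsign : B16.SignConventions D.C)`, and the three inputs the ruling R-U5c-GD names are
displayed as NAMED BINDERS ((α), (γ), the site budget) — none of them is minted here, none is hidden in a definition;
BetaPertH / (B) / (B^μ) are hidden nowhere.  What the module records is a USAGE EDGE already inside the cell's hypothesis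
H1 (T4-DAG §0 H1 as amended by R-U5c-GD: node U5c → the (2.50)-lower half at `k = K`), typed so that the (GD) currency's
denominator fields are no longer free-standing hypotheses of the U5c instantiation but consequences of the target's FIRST
binder.  NOT an estimate of Bałaban's; NOT summit progress; the numerator side of (GD) ((G3) «up», `bad_subset`,
`F_nonneg`, the entropy sum (G4)) is untouched and stays with its owners (walls G-ne7bp1-1 / G-ne7bp2-1 of the records,
R1 / (ID) / E2-rel (b)).

THE PRINTED INPUT, BY NAME (nothing re-quoted; the quotations sit at the tree declarations).  `B16.Cor3_250 C := ∃ γ > 0,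
∃ em ep, Cor3With C γ em ep`, `B16.Cor3With C γ em ep := ∀ P, (C P).flow.InInterval γ P.K → ∀ k ≤ P.K, ∀ V : (C P).Cfg k,
UVIneq (C P) k V (em (g_k)) (ep (g_k))`, and `B16.UVIneq`'s LOWER member
`χ_k(V) · exp[−(1/g_k²) A(U_k(V)) − e₋(g_k)·|T₁^{(k)}|] ≤ ρ_k(V)` — [Balaban1988Convergent] Cor. 3 (2.50) p. 264 with its
clause «depending on g_k» = the PIN (cell FINAL-STATEMENT §6d; NEVER the k-uniform reading `B16.UVBound01`, refuted for
log-normalised ρ₀ by `B16B10Shape.not_uvBound01_of_smallCouplings`).  It is used at ONE step only, the final one `k = K`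
of the run `⟨K, m, g₀ K⟩`, where TUNING (`T4Continuum.FiniteEpsData.Tuned γ g g₀`: the run stays in `]0, γ]` and ends at
`g_K = g`, [Balaban1987RG1] Thm 2 p. 259, T4-DAG D3) makes `e₋(g_K) = e₋(g)` ONE number for all `K` — K-uniformity for
THAT reason, not (0.1)'s «independent of k».  The measure on `Cfg K` (binder (β) of R-U5c-GD) is LOCATED, not posited:
`T4Continuum.FiniteEpsData.real.cfg K g₀ k : Cfg k ≃ GaugeField (F.P K) k G` transports the densities to the tree's
product Haar measure `fieldMeasure` ([Balaban1985Averaging] (10)), `T4Continuum.FiniteEpsData.dens`; and the ONE printed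
consequence of the dictionary, `∫ρ_K dV_K = ∫ρ₀ dU` ((0.4) of [Balaban1989LargeFieldI] + the push-forward identity,
[Balaban1985UV3] (6); tree `FiniteEpsData.integral_dens_eq_zero`, `integral_dens_top`), carries the bound to the fine
lattice, where the bounded source is handled by `e^{−|t|‖F‖} ≤ e^{tF}` (tree `T4GenFunBounds.exp_neg_le_exp_mul_of_abs_le`).

WHAT IS PROVED (0 `sorry`; every declaration [folklore] bookkeeping unless its docstring cites the located display).
§1 Two generic integral inequalities over any measure space: (L1) a pointwise minorant `χ·e^{−S−e} ≤ ρ` with `χ ≥ 0`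
   and `ρ` integrable integrates to `e^{−e}·∫χe^{−S} ≤ ∫ρ` (no measurability of the minorant needed: a non-integrable
   nonnegative minorant has Bochner integral `0`); (L2) for `ρ ≥ 0` integrable and a measurable observable `|F| ≤ B`,
   `e^{−|t|B}·∫ρ ≤ ∫ e^{tF}ρ`.
§2 On `T4Continuum.FiniteEpsData` (one run `⟨K, m, g₀⟩`): `smallFieldMass D K g₀ := ∫ χ_K(V) e^{−A(U_K(V))/g_K²} dV_K`
   (the integrated left member of (2.50) without its volume factor — the quantity whose FLOOR is binder (γ));
   `integrable_dens_top` (ρ_K is integrable BECAUSE `∫ρ_K dV = c·Z_ε > 0` is not a junk value), `dens_zero_nonneg`,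
   `integrable_dens_zero` (ρ₀ = c·e^{−A/g₀²}); **`exp_neg_mul_smallFieldMass_le_integral_dens`** = (2.50)-lower at
   `k = K` INTEGRATED: `e^{−e₋(g_K)|T₁^{(K)}|} · smallFieldMass ≤ ∫ρ_K dV_K`, from `(hcor : Cor3With D.C γB em ep)` and the
   run's `InInterval γB K` BY NAME; `exp_neg_mul_integral_dens_zero_le` (source monotonicity at ρ₀); the chain
   **`dressed_lower`**: `e^{−|t|B} · e^{−e₋(g_K)|T₁^{(K)}|} · smallFieldMass ≤ ∫ e^{tF(U)} ρ₀(U) dU`; and the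
   normalisation dictionary `exists_const_dressedZ` (`∫ρ_K dV_K = c·Z_ε` and `∫e^{tF}ρ₀ dU = c·dressedZ … F t` with the
   SAME `c > 0` of `real.rho_zero`: Bałaban's `ρ₀ = c·e^{−A/g₀²}` versus the apex's Wilson-normalised `schemeZ`).
§3 `structure LowEnvelope l₀ T A nlow nup C K₀` = EXACTLY the three denominator fields shared by `GlobalDom` and
   `Regeneration` (`low`, `nup_nonneg`, `ratio`); the two assemblies `globalDom_of_lowEnvelope`,
   `regeneration_of_lowEnvelope` (numerator fields supplied by their owners) and the two projections; threshold
   monotonicity; the rescaling `LowEnvelope.smul` (normalisation-agnostic: `A, nlow, nup ↦ z K · (…)`, same `C`); the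
   end-to-end corollary `exists_relWeightBound_of_lowEnvelopes` (two runs + numerator fields + (G4) ⇒
   `T4WeightBudget.RelWeightBound`, by `T4GlobalDenominator.exists_relWeightBound_of_globalDom`).
§4 THE SOCKET.  `nlowOf l₀ B Em n₁ c₀ := e^{−(l₀B + Em·n₁)}·c₀`, `constOf l₀ B Em n₁ c₀ Nup := Nup·e^{l₀B + Em·n₁}/c₀`
   (`constOf_mul_nlowOf`: their product is `Nup`, so (G5) is saturated exactly by `nup = Nup`);
   **`lowEnvelope_of_cor3With`**: for a run-index map `κ` (the Cauchy pair uses `κ = id` and `κ = (· + 1)`), tuned bare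
   couplings, a measurable observable family `|F_K| ≤ B`, and the binders
     (α) `hα : ∀ K t, |t| ≤ l₀ → K₀ ≤ K → ∫ e^{t·F(U)} ρ₀^{(κ K)}(U) dU ≤ Σ_{τ ∈ T K} A K t τ` — the H2 / R2 READING
         «the run's full term sum at source t is (at least) the dressed fine-lattice integral» (H2's bookkeeping identity
         `Z_ε(μ) = ∫ρ₀^μ dU = ∫ρ_K^μ dV_K` composed with the completeness of the (1.104)/(2.18) term family; a binder,
         never asserted; one-sided is all (G2) consumes),
     (γ) `hfloor : ∀ K, K₀ ≤ K → c₀ ≤ smallFieldMass D (κ K) (g₀ (κ K))` with `0 < c₀` — the instantiating seat's floor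
         under the small-field Wilson mass of the last step (R-U5c-GD: «c_low owed by the instantiating seat»; its VALUE
         is not minted here),
     the site budget `hsites : |T₁^{(κ K)}| ≤ n₁` (in the model `|T₁^{(K)}| = (2L^m)^4` for every `K`: the unit torus is
         fixed) and ANY numerator-side envelope `0 ≤ nup ≤ Nup`,
   the conclusion `LowEnvelope l₀ T A (nlowOf l₀ B e₋⁺ n₁ c₀) nup (constOf l₀ B e₋⁺ n₁ c₀ Nup) K₀` with
   `e₋⁺ = max (e₋(g)) 0`; and the headline **`lowEnvelope_of_endStatementBPrinted`** from `(hB : B16.EndStatementBPrinted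
   D.C)` in the quantifier order of the cell's conditional targets (`T4ContinuumYM4Torus.ForSmallCouplings`:
   `∃ γ₀ > 0, ∀ γ ≤ γ₀, ∀ g, ∃ e₋⁺ ≥ 0, ∀ g₀ tuned, …`).
What (G2)/(G5) cost, read off the socket: the (B)-lower half at ONE scale, the sign of `χ`, the dictionary's (0.4), a
bounded measurable source, and a floor `c₀` — NO relative, conditional, fibrewise or territory-local comparison.

DOCKET HONESTY (referee ruling R-GD-1, `t4/T4-REF-U5.md` §10, obligations O-R10 of the (GD) instantiating lineage — the
items THIS leaf touches).  (i) (2.50)-LOWER BY NAME, WITH ITS GRADE: the lower inequality of (2.50) is printed-ASSERTED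
([Balaban1988Convergent] Cor. 3 p. 264; [Balaban1989LargeFieldII] Thm 1 p. 355 / (0.1) p. 356) but its DERIVATION in
d = 4 is not contained in the printed pages (cell gap G-adv3-2; FINAL-STATEMENT §5 (f)); it is hypothesis-grade, enters
here ONLY through the binder `hB` / `hcor`, and under (GD) it is LOAD-BEARING for the uniqueness spine at node U5c
(T4-DAG H1 usage census, O-R9) — this leaf is where that usage edge is typed.  (ii) THE SOURCE CONSTANT'S ORIGIN: here
`C_src = e^{l₀·B}` comes from ONE-SIDED source monotonicity AT `ρ₀` on the fine lattice (`e^{−|t|B} ≤ e^{tF}`, `ρ₀ ≥ 0`)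
composed with integral preservation (0.4) — (B) is used UNDRESSED and only its lower half; H2's two-sided display
`e^{−Σ|μ_C|} ≤ f_μ ≤ e^{Σ|μ_C|}` is NOT needed for (G2).  (iii) THE χ_K-CONSTRAINED INTEGRAL LOWER BOUND = binder (γ)
`hfloor`, NAMED (`smallFieldMass`), value owed by the instantiating seat.  NOT touched here (numerator side, other owners):
R3′ (the per-live-term reading of (1.79)/(1.80)/(1.85)–(1.89)), L1-pos on the upper side, (G4) over the LIVE index set.

Deliberately NOT here: the value of `c₀` (a small-field / Wilson-action computation on the compact group at coupling
`g`: instantiating seat); the identification (α) itself (H2 / R2 owners; the (1.104) reading R3′); anything on the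
numerator side ((G3)/(G4): R1 banked re-cut, (ID) dictionary `T4PersistenceDictionary` / `T4BankedInduction`, entropy
`T4RenewalChains` / `T4RecordChains` / `T4LiveStructureGas`); the fibre-relative chain (`EventDom`, wall G-ne7bp2-1) and
the marginal currency (`T4MarginalRenewal`), which need no (B)-lower and are unaffected.
-/

open MeasureTheory Filter Topology
open scoped BigOperators

universe u

namespace Literature.MathematicalPhysics.QuantumFieldTheory.Balaban1983to89.T4StabilitySocket

open Missing T4Continuum T4WeightBudget T4GlobalDenominator T4LiveClassFibration

/-! ## §1 Two generic integral inequalities -/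

section Generic

variable {X : Type*} [MeasurableSpace X] {μ : Measure X}

/-- (L1) A pointwise minorant of the printed shape integrates: `χ ≥ 0`, `χ·e^{−S−e} ≤ ρ` pointwise, `ρ` integrable
`⟹ e^{−e} · ∫ χ e^{−S} ≤ ∫ ρ` (if the minorant is not integrable its Bochner integral is `0 ≤ ∫ρ`). [folklore] -/
theorem exp_neg_mul_integral_le_of_pointwise {ρ χ S : X → ℝ} {e : ℝ} (hχ : ∀ x, 0 ≤ χ x)
    (hpt : ∀ x, χ x * Real.exp (-S x - e) ≤ ρ x) (hρ : Integrable ρ μ) :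
    Real.exp (-e) * ∫ x, χ x * Real.exp (-S x) ∂μ ≤ ∫ x, ρ x ∂μ := by
  have hnn : ∀ x, 0 ≤ χ x * Real.exp (-S x - e) := fun x => mul_nonneg (hχ x) (Real.exp_nonneg _)
  calc Real.exp (-e) * ∫ x, χ x * Real.exp (-S x) ∂μ = ∫ x, χ x * Real.exp (-S x - e) ∂μ := by
        rw [← integral_const_mul]
        refine integral_congr_ae (Eventually.of_forall fun x => ?_)
        show Real.exp (-e) * (χ x * Real.exp (-S x)) = χ x * Real.exp (-S x - e)
        rw [show -S x - e = -S x + -e by ring, Real.exp_add]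
        ring
    _ ≤ ∫ x, ρ x ∂μ := integral_mono_of_nonneg (Eventually.of_forall hnn) hρ (Eventually.of_forall hpt)

/-- (L2) Source monotonicity: `ρ ≥ 0` integrable, `F` measurable with `|F| ≤ B` `⟹ e^{−|t|B} · ∫ρ ≤ ∫ e^{tF} ρ`. [folklore] -/
theorem exp_neg_mul_integral_le_integral_exp_mul {ρ obs : X → ℝ} {B : ℝ} (hρ0 : ∀ x, 0 ≤ ρ x)
    (hρ : Integrable ρ μ) (hobs : Measurable obs) (hbd : ∀ x, |obs x| ≤ B) (t : ℝ) :
    Real.exp (-(|t| * B)) * ∫ x, ρ x ∂μ ≤ ∫ x, Real.exp (t * obs x) * ρ x ∂μ := by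
  have hmeas : AEStronglyMeasurable (fun x => Real.exp (t * obs x) * ρ x) μ :=
    ((measurable_const.mul hobs).exp.aestronglyMeasurable).mul hρ.aestronglyMeasurable
  have hint : Integrable (fun x => Real.exp (t * obs x) * ρ x) μ := by
    refine (hρ.const_mul (Real.exp (|t| * B))).mono' hmeas (Eventually.of_forall fun x => ?_)
    rw [Real.norm_eq_abs, abs_mul, abs_of_pos (Real.exp_pos _), abs_of_nonneg (hρ0 x)]
    exact mul_le_mul_of_nonneg_right (T4GenFunBounds.exp_mul_le_of_abs_le (hbd x)) (hρ0 x)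
  rw [← integral_const_mul]
  exact integral_mono (hρ.const_mul _) hint fun x =>
    mul_le_mul_of_nonneg_right (T4GenFunBounds.exp_neg_le_exp_mul_of_abs_le (hbd x)) (hρ0 x)

end Generic

/-! ## §2 The final scale of one run of `T4Continuum.FiniteEpsData`: (2.50)-lower integrated, carried to ρ₀, dressed -/

section FinalScale

variable {F : T4Family} {G : Type*} [GaugeGroup G] [MeasurableSpace G] [HaarData G]

/-- THE SMALL-FIELD WILSON MASS OF THE LAST STEP of the run `⟨K, m, g₀⟩`:
`c_low(K) := ∫ χ_K(V) · exp[−(1/g_K²) A(U_K(V))] dV_K`, the left member of [Balaban1988Convergent] (2.50) at `k = K`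
without its volume factor, integrated over the unit-lattice configurations (transported by `real.cfg`).  Binder (γ) of
R-U5c-GD is a FLOOR under this quantity; its value is not computed in the tree. [cite: Balaban1988Convergent, Cor. 3 (2.50) p.264] -/
noncomputable def smallFieldMass (D : FiniteEpsData F G) (K : ℕ) (g₀ : ℝ) : ℝ :=
  ∫ V, (D.C ⟨K, F.m, g₀⟩).χ K ((D.real.cfg K g₀ K).symm V) *
      Real.exp (-(1 / ((D.C ⟨K, F.m, g₀⟩).flow.g K) ^ 2 *
        (D.C ⟨K, F.m, g₀⟩).wilsonBG K ((D.real.cfg K g₀ K).symm V))) ∂fieldMeasure (F.P K) K G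

/-- `c_low(K) ≥ 0` under the sign convention `χ ≥ 0`. [folklore] -/
theorem smallFieldMass_nonneg (D : FiniteEpsData F G) (hsign : B16.SignConventions D.C) (K : ℕ) (g₀ : ℝ) :
    0 ≤ smallFieldMass D K g₀ :=
  integral_nonneg fun _ => mul_nonneg (hsign _ _ _) (Real.exp_nonneg _)

/-- `ρ₀ ≥ 0`: the initial density is a positive constant times the Wilson weight (`real.rho_zero`). [folklore] -/
theorem dens_zero_nonneg (D : FiniteEpsData F G) (K : ℕ) (g₀ : ℝ) (U : GaugeField (F.P K) 0 G) :
    0 ≤ D.dens K g₀ 0 U := by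
  obtain ⟨c, hc, h⟩ := D.real.rho_zero K g₀
  have h' : D.dens K g₀ 0 U = c * boltzmann (F.P K) (g₀⁻¹ ^ 2) U := h U
  rw [h']
  exact mul_nonneg hc.le (boltzmann_pos _ _ _).le

/-- DICTIONARY TO THE APEX'S `Z` (normalisations): with THE constant `c > 0` of `real.rho_zero` (Bałaban's
normalisation `ρ₀ = c · e^{−A/g₀²}`, `c = e^{−E}` of [Balaban1988Convergent] Thm 1 p. 262) one has BOTH
`∫ρ_K dV_K = c · Z_ε` and, for every source, `∫ e^{tF(U)} ρ₀(U) dU = c · T4GenFunBounds.dressedZ (F.P K) (g₀⁻²) F t` —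
so binder (α) of §4, stated in Bałaban's normalisation, differs from the Wilson-normalised reading `Σ_T A = dressedZ`
(the apex's `T4GenFunBounds.schemeZ`) by the run's constant `c`, absorbed by `LowEnvelope.smul` (§3). [cite: Balaban1985UV3, (6) p.257] -/
theorem exists_const_dressedZ (D : FiniteEpsData F G) (K : ℕ) (g₀ : ℝ) :
    ∃ c : ℝ, 0 < c ∧
      ∫ V, D.dens K g₀ K V ∂fieldMeasure (F.P K) K G = c * partitionFn (G := G) (F.P K) (g₀⁻¹ ^ 2) ∧
      ∀ (obs : GaugeField (F.P K) 0 G → ℝ) (t : ℝ),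
        ∫ U, Real.exp (t * obs U) * D.dens K g₀ 0 U ∂fieldMeasure (F.P K) 0 G =
          c * T4GenFunBounds.dressedZ (F.P K) (g₀⁻¹ ^ 2) obs t := by
  obtain ⟨c, hc, h⟩ := D.real.rho_zero K g₀
  have h' : D.dens K g₀ 0 = fun U => c * boltzmann (F.P K) (g₀⁻¹ ^ 2) U := funext h
  refine ⟨c, hc, ?_, fun obs t => ?_⟩
  · rw [D.integral_dens_eq_zero K g₀ K le_rfl, h']
    exact integral_const_mul c _
  · rw [h', T4GenFunBounds.dressedZ, ← integral_const_mul]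
    refine integral_congr_ae (Eventually.of_forall fun U => ?_)
    show Real.exp (t * obs U) * (c * boltzmann (F.P K) (g₀⁻¹ ^ 2) U) =
      c * (Real.exp (t * obs U) * boltzmann (F.P K) (g₀⁻¹ ^ 2) U)
    ring

variable [RegularGaugeGroup G]

/-- `ρ₀` is integrable for the product Haar measure (`c · e^{−βA}`, `β = g₀⁻² ≥ 0`). [folklore] -/
theorem integrable_dens_zero (D : FiniteEpsData F G) (K : ℕ) (g₀ : ℝ) :
    Integrable (D.dens K g₀ 0) (fieldMeasure (F.P K) 0 G) := by
  obtain ⟨c, _, h⟩ := D.real.rho_zero K g₀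
  have h' : D.dens K g₀ 0 = fun U => c * boltzmann (F.P K) (g₀⁻¹ ^ 2) U := funext h
  rw [h']
  exact (integrable_boltzmann RegularGaugeGroup.measurable_reTr (F.P K) (sq_nonneg _)).const_mul c

/-- `ρ_K` (transported to the unit-lattice gauge fields) is INTEGRABLE — because its integral `∫ρ_K dV = c · Z_ε`
(`FiniteEpsData.integral_dens_top`, [Balaban1985UV3] (6)) is a positive number, hence not the junk value `0` of a
non-integrable function. [cite: Balaban1985UV3, (6) p.257] -/
theorem integrable_dens_top (D : FiniteEpsData F G) (K : ℕ) (g₀ : ℝ) :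
    Integrable (D.dens K g₀ K) (fieldMeasure (F.P K) K G) := by
  obtain ⟨c, hc, h⟩ := D.integral_dens_top K g₀
  by_contra hni
  rw [integral_undef hni] at h
  exact (mul_pos hc (partitionFn_pos' (G := G) (F.P K) (sq_nonneg _))).ne' h.symm

/-- **(2.50)-LOWER AT THE FINAL SCALE, INTEGRATED.**  From `Cor3With D.C γB em ep` BY NAME (the `Cor3_250` conjunct of
the pin, unpacked) and the run's interval hypothesis `InInterval γB K`:
`exp[−e₋(g_K)·|T₁^{(K)}|] · c_low(K) ≤ ∫ ρ_K dV_K`. [cite: Balaban1988Convergent, Cor. 3 (2.50) p.264] -/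
theorem exp_neg_mul_smallFieldMass_le_integral_dens (D : FiniteEpsData F G) (hsign : B16.SignConventions D.C)
    {γB : ℝ} {em ep : ℝ → ℝ} (hcor : B16.Cor3With D.C γB em ep) (K : ℕ) (g₀ : ℝ)
    (hI : (D.C ⟨K, F.m, g₀⟩).flow.InInterval γB K) :
    Real.exp (-(em ((D.C ⟨K, F.m, g₀⟩).flow.g K) * ((D.C ⟨K, F.m, g₀⟩).numSites K : ℝ))) *
        smallFieldMass D K g₀ ≤ ∫ V, D.dens K g₀ K V ∂fieldMeasure (F.P K) K G := by
  have hpt : ∀ V : GaugeField (F.P K) K G,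
      (D.C ⟨K, F.m, g₀⟩).χ K ((D.real.cfg K g₀ K).symm V) *
          Real.exp (-(1 / ((D.C ⟨K, F.m, g₀⟩).flow.g K) ^ 2 *
              (D.C ⟨K, F.m, g₀⟩).wilsonBG K ((D.real.cfg K g₀ K).symm V)) -
            em ((D.C ⟨K, F.m, g₀⟩).flow.g K) * ((D.C ⟨K, F.m, g₀⟩).numSites K : ℝ)) ≤
        D.dens K g₀ K V :=
    fun V => (hcor ⟨K, F.m, g₀⟩ hI K le_rfl ((D.real.cfg K g₀ K).symm V)).1
  exact exp_neg_mul_integral_le_of_pointwise (μ := fieldMeasure (F.P K) K G)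
    (S := fun V => 1 / ((D.C ⟨K, F.m, g₀⟩).flow.g K) ^ 2 * (D.C ⟨K, F.m, g₀⟩).wilsonBG K ((D.real.cfg K g₀ K).symm V))
    (fun V => hsign _ _ _) hpt (integrable_dens_top D K g₀)

/-- SOURCE MONOTONICITY AT `ρ₀`: for a measurable observable `|F| ≤ B` of the fine lattice,
`e^{−|t|B} · ∫ρ₀ dU ≤ ∫ e^{tF(U)} ρ₀(U) dU`. [folklore] -/
theorem exp_neg_mul_integral_dens_zero_le (D : FiniteEpsData F G) (K : ℕ) (g₀ : ℝ)
    {obs : GaugeField (F.P K) 0 G → ℝ} {B : ℝ} (hobs : Measurable obs) (hbd : ∀ U, |obs U| ≤ B) (t : ℝ) :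
    Real.exp (-(|t| * B)) * ∫ U, D.dens K g₀ 0 U ∂fieldMeasure (F.P K) 0 G ≤
      ∫ U, Real.exp (t * obs U) * D.dens K g₀ 0 U ∂fieldMeasure (F.P K) 0 G :=
  exp_neg_mul_integral_le_integral_exp_mul (dens_zero_nonneg D K g₀) (integrable_dens_zero D K g₀) hobs hbd t

/-- **THE (G2) CHAIN OF ONE RUN**: (2.50)-lower at `k = K` integrated, `∫ρ_K dV_K = ∫ρ₀ dU` ((0.4) + push-forward,
`FiniteEpsData.integral_dens_eq_zero`), then the source:
`e^{−|t|B} · (e^{−e₋(g_K)|T₁^{(K)}|} · c_low(K)) ≤ ∫ e^{tF(U)} ρ₀(U) dU`. [folklore] -/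
theorem dressed_lower (D : FiniteEpsData F G) (hsign : B16.SignConventions D.C)
    {γB : ℝ} {em ep : ℝ → ℝ} (hcor : B16.Cor3With D.C γB em ep) (K : ℕ) (g₀ : ℝ)
    (hI : (D.C ⟨K, F.m, g₀⟩).flow.InInterval γB K)
    {obs : GaugeField (F.P K) 0 G → ℝ} {B : ℝ} (hobs : Measurable obs) (hbd : ∀ U, |obs U| ≤ B) (t : ℝ) :
    Real.exp (-(|t| * B)) *
        (Real.exp (-(em ((D.C ⟨K, F.m, g₀⟩).flow.g K) * ((D.C ⟨K, F.m, g₀⟩).numSites K : ℝ))) *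
          smallFieldMass D K g₀) ≤
      ∫ U, Real.exp (t * obs U) * D.dens K g₀ 0 U ∂fieldMeasure (F.P K) 0 G :=
  calc Real.exp (-(|t| * B)) *
        (Real.exp (-(em ((D.C ⟨K, F.m, g₀⟩).flow.g K) * ((D.C ⟨K, F.m, g₀⟩).numSites K : ℝ))) *
          smallFieldMass D K g₀)
      ≤ Real.exp (-(|t| * B)) * ∫ V, D.dens K g₀ K V ∂fieldMeasure (F.P K) K G :=
        mul_le_mul_of_nonneg_left (exp_neg_mul_smallFieldMass_le_integral_dens D hsign hcor K g₀ hI)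
          (Real.exp_nonneg _)
    _ = Real.exp (-(|t| * B)) * ∫ U, D.dens K g₀ 0 U ∂fieldMeasure (F.P K) 0 G := by
        rw [D.integral_dens_eq_zero K g₀ K le_rfl]
    _ ≤ _ := exp_neg_mul_integral_dens_zero_le D K g₀ hobs hbd t

end FinalScale

/-! ## §3 The denominator half `LowEnvelope` of `GlobalDom` / `Regeneration` -/

section Envelope

variable {ι γ : Type*} [DecidableEq γ] {l₀ : ℝ} {T : ℕ → Finset ι} {A B : ℕ → ℝ → ι → ℝ}
  {Bad : ℕ → ℝ → Finset ι} {Fh Gh : ℕ → ι → ℝ} {nlow nup mlow mup : ℕ → ℝ → ℝ} {C : ℝ} {K₀ K₁ : ℕ} {M : ℕ → ℝ}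

/-- NAMED SHAPE `LowEnvelope l₀ T A nlow nup C K₀` (ONE run): exactly the three DENOMINATOR fields common to
`T4GlobalDenominator.GlobalDom` and `T4LiveClassFibration.Regeneration` — (G2) `nlow K t ≤ Σ_{τ ∈ T K} A K t τ`, the
envelope `nup K t ≥ 0`, (G5) `nup K t ≤ C · nlow K t` — from the threshold `K₀` on, for `|t| ≤ l₀`.  (A hypothesis
shape; §4 constructs it from the pin.) [folklore] -/
structure LowEnvelope (l₀ : ℝ) (T : ℕ → Finset ι) (A : ℕ → ℝ → ι → ℝ) (nlow nup : ℕ → ℝ → ℝ) (C : ℝ)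
    (K₀ : ℕ) : Prop where
  /-- (G2) global lower bound on the full sum -/
  low : ∀ K t, |t| ≤ l₀ → K₀ ≤ K → nlow K t ≤ ∑ τ ∈ T K, A K t τ
  /-- the upper envelope is nonnegative -/
  nup_nonneg : ∀ K t, |t| ≤ l₀ → K₀ ≤ K → 0 ≤ nup K t
  /-- (G5) the envelope and the lower bound are comparable with one constant -/
  ratio : ∀ K t, |t| ≤ l₀ → K₀ ≤ K → nup K t ≤ C * nlow K t

/-- The denominator half of a `GlobalDom`. [folklore] -/
theorem lowEnvelope_of_globalDom (h : GlobalDom l₀ T A Bad Fh nlow nup C K₀) : LowEnvelope l₀ T A nlow nup C K₀ :=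
  ⟨h.low, h.nup_nonneg, h.ratio⟩

/-- The denominator half of a `Regeneration`. [folklore] -/
theorem lowEnvelope_of_regeneration {π : ℕ → ι → γ} {Bad' : ℕ → ℝ → Finset γ} {dead : ℕ → ℝ → ι → ℝ}
    {Fc R : ℕ → γ → ℝ} (h : Regeneration l₀ π T A Bad' dead Fc R nlow nup C K₀) :
    LowEnvelope l₀ T A nlow nup C K₀ :=
  ⟨h.low, h.nup_nonneg, h.ratio⟩

/-- **ASSEMBLY OF `GlobalDom`**: the denominator half + the numerator owners' fields (`bad_subset`, (G3) `up`,
`F_nonneg`). [folklore] -/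
theorem globalDom_of_lowEnvelope (h : LowEnvelope l₀ T A nlow nup C K₀)
    (bad_subset : ∀ K t, |t| ≤ l₀ → K₀ ≤ K → Bad K t ⊆ T K)
    (up : ∀ K t, |t| ≤ l₀ → K₀ ≤ K → ∀ τ ∈ Bad K t, A K t τ ≤ Fh K τ * nup K t)
    (F_nonneg : ∀ K t, |t| ≤ l₀ → K₀ ≤ K → ∀ τ ∈ Bad K t, 0 ≤ Fh K τ) :
    GlobalDom l₀ T A Bad Fh nlow nup C K₀ :=
  ⟨bad_subset, h.low, up, F_nonneg, h.nup_nonneg, h.ratio⟩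

/-- **ASSEMBLY OF `Regeneration`**: the denominator half + the regeneration reading's own fields (`bad_subset`, (R3′)
`up`, `dead_nonneg`, (RS) `resum`, `F_nonneg`). [folklore] -/
theorem regeneration_of_lowEnvelope {π : ℕ → ι → γ} {Bad' : ℕ → ℝ → Finset γ} {dead : ℕ → ℝ → ι → ℝ}
    {Fc R : ℕ → γ → ℝ} (h : LowEnvelope l₀ T A nlow nup C K₀)
    (bad_subset : ∀ K t, |t| ≤ l₀ → K₀ ≤ K → Bad' K t ⊆ classIndex π T K)
    (up : ∀ K t, |t| ≤ l₀ → K₀ ≤ K → ∀ c ∈ Bad' K t, ∀ τ ∈ fibre π T K c,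
      A K t τ ≤ dead K t τ * Fc K c * nup K t)
    (dead_nonneg : ∀ K t, |t| ≤ l₀ → K₀ ≤ K → ∀ c ∈ Bad' K t, ∀ τ ∈ fibre π T K c, 0 ≤ dead K t τ)
    (resum : ∀ K t, |t| ≤ l₀ → K₀ ≤ K → ∀ c ∈ Bad' K t, ∑ τ ∈ fibre π T K c, dead K t τ ≤ R K c)
    (F_nonneg : ∀ K t, |t| ≤ l₀ → K₀ ≤ K → ∀ c ∈ Bad' K t, 0 ≤ Fc K c) :
    Regeneration l₀ π T A Bad' dead Fc R nlow nup C K₀ :=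
  ⟨bad_subset, h.low, up, dead_nonneg, resum, F_nonneg, h.nup_nonneg, h.ratio⟩

/-- `LowEnvelope` from `K₀` on restricts to any later threshold. [folklore] -/
theorem LowEnvelope.of_le (h : LowEnvelope l₀ T A nlow nup C K₀) (h01 : K₀ ≤ K₁) :
    LowEnvelope l₀ T A nlow nup C K₁ :=
  ⟨fun K t ht hK => h.low K t ht (h01.trans hK), fun K t ht hK => h.nup_nonneg K t ht (h01.trans hK),
    fun K t ht hK => h.ratio K t ht (h01.trans hK)⟩

/-- RESCALING (normalisation-agnostic): multiplying one run's terms and both of its normalisations by the same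
`z K ≥ 0` preserves `LowEnvelope` with the SAME constant `C` — so a term family normalised by the Wilson partition
function (`Σ_T A = dressedZ`, the apex's `schemeZ`) rather than by Bałaban's `ρ₀ = c·e^{−A/g₀²}` is served by the socket
of §4 through `z K = c_K⁻¹` (`exists_const_dressedZ`); (G3) `up` rescales the same way. [folklore] -/
theorem LowEnvelope.smul (h : LowEnvelope l₀ T A nlow nup C K₀) {z : ℕ → ℝ} (hz : ∀ K, 0 ≤ z K) :
    LowEnvelope l₀ T (fun K t τ => z K * A K t τ) (fun K t => z K * nlow K t) (fun K t => z K * nup K t) C K₀ where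
  low K t ht hK := by
    rw [← Finset.mul_sum]
    exact mul_le_mul_of_nonneg_left (h.low K t ht hK) (hz K)
  nup_nonneg K t ht hK := mul_nonneg (hz K) (h.nup_nonneg K t ht hK)
  ratio K t ht hK :=
    calc z K * nup K t ≤ z K * (C * nlow K t) := mul_le_mul_of_nonneg_left (h.ratio K t ht hK) (hz K)
      _ = C * (z K * nlow K t) := by ring

/-- Under `LowEnvelope` the lower normalisation is nonnegative wherever the envelope is POSITIVE and `C > 0`
(`0 < nup ≤ C·nlow`). [folklore] -/
theorem LowEnvelope.nlow_pos (h : LowEnvelope l₀ T A nlow nup C K₀) (hC : 0 < C) {K : ℕ} {t : ℝ} (ht : |t| ≤ l₀)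
    (hK : K₀ ≤ K) (hnup : 0 < nup K t) : 0 < nlow K t := by
  have := (hnup.trans_le (h.ratio K t ht hK))
  exact pos_of_mul_pos_right this hC.le

/-- **END TO END (two runs)**: the two denominator halves + the numerator owners' fields for both runs + the model
entropy sums (G4) with a nonnegative summable budget ⇒ SOME `RelWeightBound` (bad classes emptied below a threshold
`K₁ ≥ K₀`, `W = 𝟙_{K ≥ K₁}·C·M`) — `T4GlobalDenominator.exists_relWeightBound_of_globalDom` composed with
`globalDom_of_lowEnvelope`.  Both runs must carry the SAME constant `C` (§4: take the common `e₋⁺`, the smaller floor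
`c₀`, the larger budget `n₁` / `Nup`). [folklore] -/
theorem exists_relWeightBound_of_lowEnvelopes (hA : LowEnvelope l₀ T A nlow nup C K₀)
    (hB : LowEnvelope l₀ T B mlow mup C K₀)
    (bad_subset : ∀ K t, |t| ≤ l₀ → K₀ ≤ K → Bad K t ⊆ T K)
    (upA : ∀ K t, |t| ≤ l₀ → K₀ ≤ K → ∀ τ ∈ Bad K t, A K t τ ≤ Fh K τ * nup K t)
    (upB : ∀ K t, |t| ≤ l₀ → K₀ ≤ K → ∀ τ ∈ Bad K t, B K t τ ≤ Gh K τ * mup K t)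
    (F_nonneg : ∀ K t, |t| ≤ l₀ → K₀ ≤ K → ∀ τ ∈ Bad K t, 0 ≤ Fh K τ)
    (G_nonneg : ∀ K t, |t| ≤ l₀ → K₀ ≤ K → ∀ τ ∈ Bad K t, 0 ≤ Gh K τ)
    (hC : 0 ≤ C) (hM0 : ∀ K, 0 ≤ M K)
    (hF : ∀ K t, |t| ≤ l₀ → K₀ ≤ K → ∑ τ ∈ Bad K t, Fh K τ ≤ M K)
    (hG : ∀ K t, |t| ≤ l₀ → K₀ ≤ K → ∑ τ ∈ Bad K t, Gh K τ ≤ M K) (hMs : Summable M) :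
    ∃ K₁, K₀ ≤ K₁ ∧ RelWeightBound l₀ T A B (fun K t => if K₁ ≤ K then Bad K t else ∅)
      (Set.indicator {K | K₁ ≤ K} (fun K => C * M K)) :=
  exists_relWeightBound_of_globalDom (globalDom_of_lowEnvelope hA bad_subset upA F_nonneg)
    (globalDom_of_lowEnvelope hB bad_subset upB G_nonneg) hC hM0 hF hG hMs

end Envelope

/-! ## §4 THE SOCKET: `LowEnvelope` from the pinned (B), at the final scale of the tuned runs -/

section Socket

/-- The socket's LOWER NORMALISATION `nlow K t := e^{−(l₀·B + Em·n₁)} · c₀` (constant in `K` and `t`): the source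
factor `e^{−l₀‖F‖}`, the (2.50) volume factor `e^{−e₋⁺|T₁|}`, the floor `c₀` under the small-field Wilson mass. [folklore] -/
noncomputable def nlowOf (l₀ B Em n₁ c₀ : ℝ) : ℕ → ℝ → ℝ := fun _ _ => Real.exp (-(l₀ * B + Em * n₁)) * c₀

/-- The socket's (G5) CONSTANT `C := Nup · e^{l₀·B + Em·n₁} / c₀` for a numerator-side envelope bounded by `Nup`
(volume-dependent through `n₁`, `K`-uniform). [folklore] -/
noncomputable def constOf (l₀ B Em n₁ c₀ Nup : ℝ) : ℝ := Nup * Real.exp (l₀ * B + Em * n₁) / c₀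

/-- `C · nlow = Nup` exactly (`c₀ ≠ 0`): (G5) is saturated by `nup = Nup`. [folklore] -/
theorem constOf_mul_nlowOf {l₀ B Em n₁ c₀ Nup : ℝ} (hc₀ : c₀ ≠ 0) (K : ℕ) (t : ℝ) :
    constOf l₀ B Em n₁ c₀ Nup * nlowOf l₀ B Em n₁ c₀ K t = Nup := by
  simp only [constOf, nlowOf]
  rw [Real.exp_neg]
  have hE : Real.exp (l₀ * B + Em * n₁) ≠ 0 := (Real.exp_pos _).ne'
  field_simp

/-- `0 ≤ C` as soon as `0 ≤ Nup` and `0 ≤ c₀`. [folklore] -/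
theorem constOf_nonneg {l₀ B Em n₁ c₀ Nup : ℝ} (hNup : 0 ≤ Nup) (hc₀ : 0 ≤ c₀) :
    0 ≤ constOf l₀ B Em n₁ c₀ Nup :=
  div_nonneg (mul_nonneg hNup (Real.exp_nonneg _)) hc₀

/-- `0 < nlow` as soon as `0 < c₀`. [folklore] -/
theorem nlowOf_pos {l₀ B Em n₁ c₀ : ℝ} (hc₀ : 0 < c₀) (K : ℕ) (t : ℝ) : 0 < nlowOf l₀ B Em n₁ c₀ K t :=
  mul_pos (Real.exp_pos _) hc₀

variable {F : T4Family} {G : Type*} [GaugeGroup G] [MeasurableSpace G] [HaarData G] [RegularGaugeGroup G]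

/-- **THE (G2)/(G5) SOCKET, `Cor3With` form.**  One `FiniteEpsData` `D`, the `Cor3_250` conjunct of the pin UNPACKED as
`(hcor : B16.Cor3With D.C γB em ep)`, tuned bare couplings within `]0, γ] ⊆ ]0, γB]` ending at `g_K = g`, a run-index map
`κ` (the Cauchy pair of node U5c uses `κ = id` and `κ = (· + 1)`), a measurable observable family `|F_K| ≤ B`; the
binders (α) `hα` (H2/R2 reading: the full term sum at source `t` dominates the dressed fine-lattice integral of the run
`κ K`), (γ) `hfloor` (a floor `0 < c₀ ≤ c_low(κ K)` from `K₀` on), the site budget `hsites`, and ANY numerator-side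
envelope `0 ≤ nup ≤ Nup`.  Conclusion: `LowEnvelope` with `nlow = e^{−(l₀B + e₋⁺·n₁)}·c₀`, `C = Nup·e^{l₀B + e₋⁺·n₁}/c₀`,
`e₋⁺ = max (e₋(g)) 0` — ONE pair of numbers for every `K` (T4-DAG D3: `g_K = g`). [folklore] -/
theorem lowEnvelope_of_cor3With (D : FiniteEpsData F G) (hsign : B16.SignConventions D.C)
    {γB γ g : ℝ} {em ep : ℝ → ℝ} {g₀ : ℕ → ℝ} (hcor : B16.Cor3With D.C γB em ep) (hγ : γ ≤ γB)
    (htuned : D.Tuned γ g g₀) (κ : ℕ → ℕ)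
    {obs : (K : ℕ) → GaugeField (F.P K) 0 G → ℝ} {B l₀ : ℝ}
    (hobs : ∀ K, Measurable (obs K)) (hbd : ∀ K U, |obs K U| ≤ B)
    {ι : Type*} {T : ℕ → Finset ι} {A : ℕ → ℝ → ι → ℝ} {K₀ : ℕ}
    (hα : ∀ K t, |t| ≤ l₀ → K₀ ≤ K →
      ∫ U, Real.exp (t * obs (κ K) U) * D.dens (κ K) (g₀ (κ K)) 0 U ∂fieldMeasure (F.P (κ K)) 0 G ≤
        ∑ τ ∈ T K, A K t τ)
    {c₀ n₁ : ℝ} (hc₀ : 0 < c₀) (hfloor : ∀ K, K₀ ≤ K → c₀ ≤ smallFieldMass D (κ K) (g₀ (κ K)))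
    (hsites : ∀ K, K₀ ≤ K → ((D.C ⟨κ K, F.m, g₀ (κ K)⟩).numSites (κ K) : ℝ) ≤ n₁)
    {nup : ℕ → ℝ → ℝ} {Nup : ℝ} (hnup : ∀ K t, |t| ≤ l₀ → K₀ ≤ K → 0 ≤ nup K t ∧ nup K t ≤ Nup) :
    LowEnvelope l₀ T A (nlowOf l₀ B (max (em g) 0) n₁ c₀) nup (constOf l₀ B (max (em g) 0) n₁ c₀ Nup) K₀ where
  low K t ht hK := by
    have hB0 : 0 ≤ B := (abs_nonneg _).trans (hbd (κ K) 1)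
    have hI : (D.C ⟨κ K, F.m, g₀ (κ K)⟩).flow.InInterval γB (κ K) := fun k hk =>
      ⟨((htuned (κ K)).1 k hk).1, ((htuned (κ K)).1 k hk).2.trans hγ⟩
    have hgK : (D.C ⟨κ K, F.m, g₀ (κ K)⟩).flow.g (κ K) = g := (htuned (κ K)).2
    have hchain := dressed_lower D hsign hcor (κ K) (g₀ (κ K)) hI (hobs (κ K)) (hbd (κ K)) t
    rw [hgK] at hchain
    have hn0 : 0 ≤ ((D.C ⟨κ K, F.m, g₀ (κ K)⟩).numSites (κ K) : ℝ) := Nat.cast_nonneg _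
    have h1 : |t| * B ≤ l₀ * B := mul_le_mul_of_nonneg_right ht hB0
    have h2 : em g * ((D.C ⟨κ K, F.m, g₀ (κ K)⟩).numSites (κ K) : ℝ) ≤
        max (em g) 0 * ((D.C ⟨κ K, F.m, g₀ (κ K)⟩).numSites (κ K) : ℝ) :=
      mul_le_mul_of_nonneg_right (le_max_left _ _) hn0
    have h3 : max (em g) 0 * ((D.C ⟨κ K, F.m, g₀ (κ K)⟩).numSites (κ K) : ℝ) ≤ max (em g) 0 * n₁ :=
      mul_le_mul_of_nonneg_left (hsites K hK) (le_max_right _ _)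
    calc nlowOf l₀ B (max (em g) 0) n₁ c₀ K t = Real.exp (-(l₀ * B + max (em g) 0 * n₁)) * c₀ := rfl
      _ ≤ Real.exp (-(|t| * B)) *
            (Real.exp (-(em g * ((D.C ⟨κ K, F.m, g₀ (κ K)⟩).numSites (κ K) : ℝ))) *
              smallFieldMass D (κ K) (g₀ (κ K))) := by
          rw [← mul_assoc, ← Real.exp_add]
          exact mul_le_mul (Real.exp_le_exp.mpr (by linarith)) (hfloor K hK) hc₀.le (Real.exp_nonneg _)
      _ ≤ ∫ U, Real.exp (t * obs (κ K) U) * D.dens (κ K) (g₀ (κ K)) 0 U ∂fieldMeasure (F.P (κ K)) 0 G := hchain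
      _ ≤ ∑ τ ∈ T K, A K t τ := hα K t ht hK
  nup_nonneg K t ht hK := (hnup K t ht hK).1
  ratio K t ht hK := by
    rw [constOf_mul_nlowOf hc₀.ne']
    exact (hnup K t ht hK).2

/-- **THE (G2)/(G5) SOCKET FROM THE PIN** `(hB : B16.EndStatementBPrinted D.C)`, in the quantifier order of the cell's
conditional targets (`T4ContinuumYM4Torus.ForSmallCouplings`): there is `γ₀ > 0` (the `γ` of `Cor3_250`) such that for
every `γ ≤ γ₀` and every renormalised coupling `g` there is ONE number `e₋⁺ ≥ 0` (`= max (e₋(g)) 0`) with which, for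
every tuned family of bare couplings and every choice of the binders (α), (γ), site budget and numerator envelope,
`LowEnvelope l₀ T A (nlowOf l₀ B e₋⁺ n₁ c₀) nup (constOf l₀ B e₋⁺ n₁ c₀ Nup) K₀` holds.  The `Thm1Printed` conjunct of
the pin is not used. [folklore] -/
theorem lowEnvelope_of_endStatementBPrinted (D : FiniteEpsData F G) (hsign : B16.SignConventions D.C)
    (hB : B16.EndStatementBPrinted D.C)
    (obs : (K : ℕ) → GaugeField (F.P K) 0 G → ℝ) (B l₀ : ℝ)
    (hobs : ∀ K, Measurable (obs K)) (hbd : ∀ K U, |obs K U| ≤ B) :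
    ∃ γ₀ : ℝ, 0 < γ₀ ∧ ∀ γ g : ℝ, γ ≤ γ₀ → ∃ Em : ℝ, 0 ≤ Em ∧
      ∀ (g₀ : ℕ → ℝ), D.Tuned γ g g₀ → ∀ (κ : ℕ → ℕ) {ι : Type u} (T : ℕ → Finset ι) (A : ℕ → ℝ → ι → ℝ) (K₀ : ℕ),
        (∀ K t, |t| ≤ l₀ → K₀ ≤ K →
          ∫ U, Real.exp (t * obs (κ K) U) * D.dens (κ K) (g₀ (κ K)) 0 U ∂fieldMeasure (F.P (κ K)) 0 G ≤
            ∑ τ ∈ T K, A K t τ) →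
        ∀ (c₀ n₁ : ℝ), 0 < c₀ → (∀ K, K₀ ≤ K → c₀ ≤ smallFieldMass D (κ K) (g₀ (κ K))) →
          (∀ K, K₀ ≤ K → ((D.C ⟨κ K, F.m, g₀ (κ K)⟩).numSites (κ K) : ℝ) ≤ n₁) →
        ∀ (nup : ℕ → ℝ → ℝ) (Nup : ℝ), (∀ K t, |t| ≤ l₀ → K₀ ≤ K → 0 ≤ nup K t ∧ nup K t ≤ Nup) →
          LowEnvelope l₀ T A (nlowOf l₀ B Em n₁ c₀) nup (constOf l₀ B Em n₁ c₀ Nup) K₀ := by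
  obtain ⟨γB, hγB, em, ep, hcor⟩ := hB.2
  refine ⟨γB, hγB, fun γ g hγ => ⟨max (em g) 0, le_max_right _ _, ?_⟩⟩
  intro g₀ htuned κ ι T A K₀ hα c₀ n₁ hc₀ hfloor hsites nup Nup hnup
  exact lowEnvelope_of_cor3With D hsign hcor hγ htuned κ hobs hbd hα hc₀ hfloor hsites hnup

/-- **… AND INTO (GD)**: with the numerator owners' fields the pin yields `GlobalDom` itself (one run). [folklore] -/
theorem globalDom_of_cor3With (D : FiniteEpsData F G) (hsign : B16.SignConventions D.C)
    {γB γ g : ℝ} {em ep : ℝ → ℝ} {g₀ : ℕ → ℝ} (hcor : B16.Cor3With D.C γB em ep) (hγ : γ ≤ γB)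
    (htuned : D.Tuned γ g g₀) (κ : ℕ → ℕ)
    {obs : (K : ℕ) → GaugeField (F.P K) 0 G → ℝ} {B l₀ : ℝ}
    (hobs : ∀ K, Measurable (obs K)) (hbd : ∀ K U, |obs K U| ≤ B)
    {ι : Type*} {T : ℕ → Finset ι} {A : ℕ → ℝ → ι → ℝ} {Bad : ℕ → ℝ → Finset ι} {Fh : ℕ → ι → ℝ} {K₀ : ℕ}
    (hα : ∀ K t, |t| ≤ l₀ → K₀ ≤ K →
      ∫ U, Real.exp (t * obs (κ K) U) * D.dens (κ K) (g₀ (κ K)) 0 U ∂fieldMeasure (F.P (κ K)) 0 G ≤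
        ∑ τ ∈ T K, A K t τ)
    {c₀ n₁ : ℝ} (hc₀ : 0 < c₀) (hfloor : ∀ K, K₀ ≤ K → c₀ ≤ smallFieldMass D (κ K) (g₀ (κ K)))
    (hsites : ∀ K, K₀ ≤ K → ((D.C ⟨κ K, F.m, g₀ (κ K)⟩).numSites (κ K) : ℝ) ≤ n₁)
    {nup : ℕ → ℝ → ℝ} {Nup : ℝ} (hnup : ∀ K t, |t| ≤ l₀ → K₀ ≤ K → 0 ≤ nup K t ∧ nup K t ≤ Nup)
    (bad_subset : ∀ K t, |t| ≤ l₀ → K₀ ≤ K → Bad K t ⊆ T K)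
    (up : ∀ K t, |t| ≤ l₀ → K₀ ≤ K → ∀ τ ∈ Bad K t, A K t τ ≤ Fh K τ * nup K t)
    (F_nonneg : ∀ K t, |t| ≤ l₀ → K₀ ≤ K → ∀ τ ∈ Bad K t, 0 ≤ Fh K τ) :
    GlobalDom l₀ T A Bad Fh (nlowOf l₀ B (max (em g) 0) n₁ c₀) nup (constOf l₀ B (max (em g) 0) n₁ c₀ Nup) K₀ :=
  globalDom_of_lowEnvelope (lowEnvelope_of_cor3With D hsign hcor hγ htuned κ hobs hbd hα hc₀ hfloor hsites hnup)
    bad_subset up F_nonneg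

end Socket

end Literature.MathematicalPhysics.QuantumFieldTheory.Balaban1983to89.T4StabilitySocket
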